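import Summits.Ventures.PercRepro.RankLevelSetLevelTwelveGXTFormZA
import Summits.Ventures.PercRepro.RankLevelSetLevelTwelveGXTFormZB
import Summits.Ventures.PercRepro.RankLevelSetLevelTwelveGXTFormZC
import Summits.Ventures.PercRepro.RankLevelSetLevelTwelveGXTFormZD
import Summits.Ventures.PercRepro.RankLevelSetLevelTwelveGXTFormZE
import Summits.Ventures.PercRepro.RankLevelSetLevelTwelveGXTFormZF
import Summits.Ventures.PercRepro.RankLevelSetLevelTwelveGXTFormZG
import Summits.Ventures.PercRepro.RankLevelSetLevelTwelveGXTFormZH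
import Summits.Ventures.PercRepro.RankLevelSetLevelTwelveGXTFormZI
import Summits.Ventures.PercRepro.RankLevelSetLevelTwelveGXTFormZJ
import Summits.Ventures.PercRepro.RankLevelSetLevelTwelveGXTFormZK
import Summits.Ventures.PercRepro.RankLevelSetLevelTwelveGXTFormZL
import Summits.Ventures.PercRepro.RankLevelSetLevelTwelveGXTFormZM
import Summits.Ventures.PercRepro.RankLevelSetLevelTwelveGXTFormZN
import Summits.Ventures.PercRepro.RankLevelSetLevelTwelveGXTFormZO
import Summits.Ventures.PercRepro.RankLevelSetLevelTwelveGXTFormZP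
import Summits.Ventures.PercRepro.RankLevelSetLevelTwelveGXTFormZQB
import Summits.Ventures.PercRepro.RankLevelSetLevelTwelveGXTFormZRB
import Summits.Ventures.PercRepro.RankLevelSetLevelTwelveGXTFormZSB
import Summits.Ventures.PercRepro.RankLevelSetLevelTwelveGXTFormZT
import Summits.Ventures.PercRepro.RankLevelSetLevelTwelveGXTFormZU
import Summits.Ventures.PercRepro.RankLevelSetLevelTwelveGXTFormZV
import Summits.Ventures.PercRepro.RankLevelSetLevelTwelveGXTFormZW
import Summits.Ventures.PercRepro.RankLevelSetLevelTwelveGXTFormZX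
import Summits.Ventures.PercRepro.RankLevelSetLevelTwelveGXTFormZY
import Summits.Ventures.PercRepro.RankLevelSetLevelTwelveGXTFormZZ
import Summits.Ventures.PercRepro.RankLevelSetLevelTwelveGXTFormYA
import Summits.Ventures.PercRepro.RankLevelSetLevelTwelveGXTFormYB
import Summits.Ventures.PercRepro.RankLevelSetLevelTwelveGXTFormYC
import Summits.Ventures.PercRepro.RankLevelSetLevelTwelveGXTFormYD
import Summits.Ventures.PercRepro.RankLevelSetLevelTwelveGXTFormYE
import Summits.Ventures.PercRepro.RankLevelSetLevelTwelveGXTFormYF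
import Summits.Ventures.PercRepro.RankLevelSetLevelTwelveGXTFormYG
import Summits.Ventures.PercRepro.RankLevelSetLevelTwelveGXTFormYH
import Summits.Ventures.PercRepro.RankLevelSetLevelTwelveGXTFormYI
import Summits.Ventures.PercRepro.RankLevelSetLevelTwelveGXTFormYJ
import Summits.Ventures.PercRepro.RankLevelSetLevelTwelveGXTFormYK
import Summits.Ventures.PercRepro.RankLevelSetLevelTwelveGXTFormYL
import Summits.Ventures.PercRepro.RankLevelSetLevelTwelveGXTFormYM
import Summits.Ventures.PercRepro.RankLevelSetLevelTwelveGXTFormYN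
import Summits.Ventures.PercRepro.RankLevelSetLevelTwelveGXTFormYO
import Summits.Ventures.PercRepro.RankLevelSetLevelTwelveGXTFormYP
import Summits.Ventures.PercRepro.RankLevelSetLevelTwelveGXTFormYQ
import Summits.Ventures.PercRepro.RankLevelSetLevelTwelveGXTFormYR
import Summits.Ventures.PercRepro.RankLevelSetLevelTwelveGXTFormYS
import Summits.Ventures.PercRepro.RankLevelSetLevelTwelveGXTFormYT
import Summits.Ventures.PercRepro.RankLevelSetLevelTwelveGXTFormYU
import Summits.Ventures.PercRepro.RankLevelSetLevelTwelveGXTFormYV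
import Summits.Ventures.PercRepro.RankLevelSetLevelTwelveGXTFormYW
import Summits.Ventures.PercRepro.RankLevelSetLevelTwelveGXTFormYX
import Summits.Ventures.PercRepro.RankLevelSetLevelTwelveGXTFormYY
import Summits.Ventures.PercRepro.RankLevelSetLevelTwelveGXTFormYZ
import Summits.Ventures.PercRepro.RankLevelSetLevelTwelveGXTFormXA
import Summits.Ventures.PercRepro.RankLevelSetLevelTwelveGXTFormXB
import Summits.Ventures.PercRepro.RankLevelSetLevelTwelveGXTFormXC
import Summits.Ventures.PercRepro.RankLevelSetLevelTwelveGXTFormXD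
import Summits.Ventures.PercRepro.RankLevelSetLevelTwelveGXTFormXE
import Summits.Ventures.PercRepro.RankLevelSetLevelTwelveGXTFormXF
import Summits.Ventures.PercRepro.RankLevelSetLevelTwelveGXTFormXG
import Summits.Ventures.PercRepro.RankLevelSetLevelTwelveGXTFormXH
import Summits.Ventures.PercRepro.RankLevelSetLevelTwelveGXTFormXI
import Summits.Ventures.PercRepro.RankLevelSetLevelTwelveGXTFormXJ
import Summits.Ventures.PercRepro.RankLevelSetLevelTwelveGXTFormXK
import Summits.Ventures.PercRepro.RankLevelSetLevelTwelveGXTFormXL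
import Summits.Ventures.PercRepro.RankLevelSetLevelTwelveGXTFormXM
import Summits.Ventures.PercRepro.RankLevelSetLevelTwelveGXTFormXN
import Summits.Ventures.PercRepro.RankLevelSetLevelTwelveGXTFormXO

/-!
# PercRepro — THE LEVEL-`12` DISPATCHER OF THE GXT CHAIN (THE GIANT-EXACT COUNT WITH LEMMA T5) AT BASE `1880`: the per-corank form
`(c₁, c₂)`, `(P_d^gxt)` and the `Y`-tail for `13 ≤ d ≤ 2681` (p2, gen 36/37; a feeder for S4 — the top of the `q = 12` window, from
`2,768`). The 67 parts ZA … XO (ZQ, ZR, ZS through their re-issues ZQB, ZRB, ZSB — the accepted originals p735843 / p735841 / p735840 got no farm olean). Axioms: standard.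
-/

set_option exponentiation.threshold 8192

namespace PercRepro

namespace ThmN

/-- **THE PER-CORANK FORM OF THE LEVEL-`12` GXT CHAIN AT BASE `1880`**: for every corank `13 ≤ d ≤ 2681`, every `p ≥ 1880` and every
`n ≥ 1880 + d` there are `0 < c₂ < c₁` with the certificate `c₁·(C(n,12) + σ̄·Π_E′ + 2^{min 2559 (12+d)}) ≤ c₂·2^{d−12}·C(p+12, 12)` and
the tail `c₁·G₁₂(d, n) ≤ (c₁ − c₂)·2^n` (the form `(c₁, c₂)` of every corank in FORMS12GXT_1880.txt, lane tools/; LEMMA T5 in `Π_E`; the mid weight in the closed form σ̄ of RankLevelSetLevelElevenSigmaBarGXT). -/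
theorem gxt_form_twelve (d : ℕ) (hd1 : 13 ≤ d) (hd2 : d ≤ 2681) (p : ℕ) (hp : 1880 ≤ p) (n : ℕ) (hn : 1880 + d ≤ n) :
    ∃ c₁ c₂ : ℕ, 0 < c₂ ∧ c₂ < c₁ ∧
    ((c₁ : ℕ) : ℚ) * ((((p + d).choose 12 : ℕ) : ℚ) + (∑ j ∈ Finset.range (min (d - 12) 60), ((Nat.choose (min 2546 (max ((d + min 1268 d) / 2 + 1) (min 1267 (d - 1) + 2) - 2)) j : ℕ) : ℚ) / (((j + 1) + 3 * (j + 1).choose 2 + 3 * (j + 1).choose 3 + 2 * (j + 1).choose 4 : ℕ) : ℚ) + (if 60 < d - 12 then (66 / 5 : ℚ) * 2 ^ (min 2546 (max ((d + min 1268 d) / 2 + 1) (min 1267 (d - 1) + 2) - 2) + 4) / ((((min 2546 (max ((d + min 1268 d) / 2 + 1) (min 1267 (d - 1) + 2) - 2)) + 1) * ((min 2546 (max ((d + min 1268 d) / 2 + 1) (min 1267 (d - 1) + 2) - 2)) + 2) * ((min 2546 (max ((d + min 1268 d) / 2 + 1) (min 1267 (d - 1) + 2) - 2)) + 3) * ((min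 2546 (max ((d + min 1268 d) / 2 + 1) (min 1267 (d - 1) + 2) - 2)) + 4) : ℕ) : ℚ) else 0)) *
      (((d * (d + 1) / 2 : ℕ) : ℚ) * ((p + d).choose 10 : ℚ) + ((d * (d + 1) * (d + 2) / 3 : ℕ) : ℚ) * ((p + d).choose 9 : ℚ) + ((7 * d * (d + 1) * (d + 2) * (d + 3) / 48 : ℕ) : ℚ) * ((p + d).choose 8 : ℚ) + (((d + 5).choose 6 : ℕ) : ℚ) * ((p + d).choose 7 : ℚ) + (((d + 6).choose 7 : ℕ) : ℚ) * ((p + d).choose 6 : ℚ) + (((d + 7).choose 8 : ℕ) : ℚ) * ((p + d).choose 5 : ℚ) + (((d + 8).choose 9 : ℕ) : ℚ) * ((p + d).choose 4 : ℚ) + (((d + 9).choose 10 : ℕ) : ℚ) * ((p + d).choose 3 : ℚ) + (((d + 10).choose 11 : ℕ) : ℚ) * ((p + d).choose 2 : ℚ) + (((d + 11).choose 12 : ℕ) : ℚ) * (p + d : ℚ) + (((d + 12).choose 13 : ℕ) : ℚ)) +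
      (2 : ℚ) ^ (min 2559 (12 + d))) ≤
      ((c₂ : ℕ) : ℚ) * 2 ^ (d - 12) * (((p + 12).choose 12 : ℕ) : ℚ) ∧
      c₁ * (n.choose 12 * 2 ^ (min 2547 d) + n.choose 11 * 2 ^ 1268 + n.choose 10 * 2 ^ 629 + n.choose 9 * 2 ^ 310 + n.choose 8 * 2 ^ 151 + n.choose 7 * 2 ^ 72 + n.choose 6 * 2 ^ 33 + n.choose 5 * 2 ^ 14 + n.choose 4 * 2 ^ 6 + n.choose 3 * 2 ^ 3 + n.choose 2 * 2 + n + 1 + ∑ j ∈ Finset.range (d + 1), n.choose j) ≤ (c₁ - c₂) * 2 ^ n := by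
  rcases Nat.lt_or_ge d (52 + 1) with h0 | h0
  · exact gxt_form_twelve_ZA d hd1 (by omega) p hp n hn
  rcases Nat.lt_or_ge d (92 + 1) with h1 | h1
  · exact gxt_form_twelve_ZB d (by omega) (by omega) p hp n hn
  rcases Nat.lt_or_ge d (132 + 1) with h2 | h2
  · exact gxt_form_twelve_ZC d (by omega) (by omega) p hp n hn
  rcases Nat.lt_or_ge d (172 + 1) with h3 | h3
  · exact gxt_form_twelve_ZD d (by omega) (by omega) p hp n hn
  rcases Nat.lt_or_ge d (212 + 1) with h4 | h4
  · exact gxt_form_twelve_ZE d (by omega) (by omega) p hp n hn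
  rcases Nat.lt_or_ge d (252 + 1) with h5 | h5
  · exact gxt_form_twelve_ZF d (by omega) (by omega) p hp n hn
  rcases Nat.lt_or_ge d (292 + 1) with h6 | h6
  · exact gxt_form_twelve_ZG d (by omega) (by omega) p hp n hn
  rcases Nat.lt_or_ge d (332 + 1) with h7 | h7
  · exact gxt_form_twelve_ZH d (by omega) (by omega) p hp n hn
  rcases Nat.lt_or_ge d (372 + 1) with h8 | h8
  · exact gxt_form_twelve_ZI d (by omega) (by omega) p hp n hn
  rcases Nat.lt_or_ge d (412 + 1) with h9 | h9
  · exact gxt_form_twelve_ZJ d (by omega) (by omega) p hp n hn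
  rcases Nat.lt_or_ge d (452 + 1) with h10 | h10
  · exact gxt_form_twelve_ZK d (by omega) (by omega) p hp n hn
  rcases Nat.lt_or_ge d (492 + 1) with h11 | h11
  · exact gxt_form_twelve_ZL d (by omega) (by omega) p hp n hn
  rcases Nat.lt_or_ge d (532 + 1) with h12 | h12
  · exact gxt_form_twelve_ZM d (by omega) (by omega) p hp n hn
  rcases Nat.lt_or_ge d (572 + 1) with h13 | h13
  · exact gxt_form_twelve_ZN d (by omega) (by omega) p hp n hn
  rcases Nat.lt_or_ge d (612 + 1) with h14 | h14
  · exact gxt_form_twelve_ZO d (by omega) (by omega) p hp n hn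
  rcases Nat.lt_or_ge d (652 + 1) with h15 | h15
  · exact gxt_form_twelve_ZP d (by omega) (by omega) p hp n hn
  rcases Nat.lt_or_ge d (692 + 1) with h16 | h16
  · exact ZQB.gxt_form_twelve_ZQ d (by omega) (by omega) p hp n hn
  rcases Nat.lt_or_ge d (732 + 1) with h17 | h17
  · exact ZRB.gxt_form_twelve_ZR d (by omega) (by omega) p hp n hn
  rcases Nat.lt_or_ge d (772 + 1) with h18 | h18
  · exact ZSB.gxt_form_twelve_ZS d (by omega) (by omega) p hp n hn
  rcases Nat.lt_or_ge d (812 + 1) with h19 | h19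
  · exact gxt_form_twelve_ZT d (by omega) (by omega) p hp n hn
  rcases Nat.lt_or_ge d (852 + 1) with h20 | h20
  · exact gxt_form_twelve_ZU d (by omega) (by omega) p hp n hn
  rcases Nat.lt_or_ge d (892 + 1) with h21 | h21
  · exact gxt_form_twelve_ZV d (by omega) (by omega) p hp n hn
  rcases Nat.lt_or_ge d (932 + 1) with h22 | h22
  · exact gxt_form_twelve_ZW d (by omega) (by omega) p hp n hn
  rcases Nat.lt_or_ge d (972 + 1) with h23 | h23
  · exact gxt_form_twelve_ZX d (by omega) (by omega) p hp n hn
  rcases Nat.lt_or_ge d (1012 + 1) with h24 | h24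
  · exact gxt_form_twelve_ZY d (by omega) (by omega) p hp n hn
  rcases Nat.lt_or_ge d (1052 + 1) with h25 | h25
  · exact gxt_form_twelve_ZZ d (by omega) (by omega) p hp n hn
  rcases Nat.lt_or_ge d (1092 + 1) with h26 | h26
  · exact gxt_form_twelve_YA d (by omega) (by omega) p hp n hn
  rcases Nat.lt_or_ge d (1132 + 1) with h27 | h27
  · exact gxt_form_twelve_YB d (by omega) (by omega) p hp n hn
  rcases Nat.lt_or_ge d (1172 + 1) with h28 | h28
  · exact gxt_form_twelve_YC d (by omega) (by omega) p hp n hn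
  rcases Nat.lt_or_ge d (1212 + 1) with h29 | h29
  · exact gxt_form_twelve_YD d (by omega) (by omega) p hp n hn
  rcases Nat.lt_or_ge d (1252 + 1) with h30 | h30
  · exact gxt_form_twelve_YE d (by omega) (by omega) p hp n hn
  rcases Nat.lt_or_ge d (1292 + 1) with h31 | h31
  · exact gxt_form_twelve_YF d (by omega) (by omega) p hp n hn
  rcases Nat.lt_or_ge d (1332 + 1) with h32 | h32
  · exact gxt_form_twelve_YG d (by omega) (by omega) p hp n hn
  rcases Nat.lt_or_ge d (1372 + 1) with h33 | h33
  · exact gxt_form_twelve_YH d (by omega) (by omega) p hp n hn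
  rcases Nat.lt_or_ge d (1412 + 1) with h34 | h34
  · exact gxt_form_twelve_YI d (by omega) (by omega) p hp n hn
  rcases Nat.lt_or_ge d (1452 + 1) with h35 | h35
  · exact gxt_form_twelve_YJ d (by omega) (by omega) p hp n hn
  rcases Nat.lt_or_ge d (1492 + 1) with h36 | h36
  · exact gxt_form_twelve_YK d (by omega) (by omega) p hp n hn
  rcases Nat.lt_or_ge d (1532 + 1) with h37 | h37
  · exact gxt_form_twelve_YL d (by omega) (by omega) p hp n hn
  rcases Nat.lt_or_ge d (1572 + 1) with h38 | h38
  · exact gxt_form_twelve_YM d (by omega) (by omega) p hp n hn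
  rcases Nat.lt_or_ge d (1612 + 1) with h39 | h39
  · exact gxt_form_twelve_YN d (by omega) (by omega) p hp n hn
  rcases Nat.lt_or_ge d (1652 + 1) with h40 | h40
  · exact gxt_form_twelve_YO d (by omega) (by omega) p hp n hn
  rcases Nat.lt_or_ge d (1692 + 1) with h41 | h41
  · exact gxt_form_twelve_YP d (by omega) (by omega) p hp n hn
  rcases Nat.lt_or_ge d (1732 + 1) with h42 | h42
  · exact gxt_form_twelve_YQ d (by omega) (by omega) p hp n hn
  rcases Nat.lt_or_ge d (1772 + 1) with h43 | h43
  · exact gxt_form_twelve_YR d (by omega) (by omega) p hp n hn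
  rcases Nat.lt_or_ge d (1812 + 1) with h44 | h44
  · exact gxt_form_twelve_YS d (by omega) (by omega) p hp n hn
  rcases Nat.lt_or_ge d (1852 + 1) with h45 | h45
  · exact gxt_form_twelve_YT d (by omega) (by omega) p hp n hn
  rcases Nat.lt_or_ge d (1892 + 1) with h46 | h46
  · exact gxt_form_twelve_YU d (by omega) (by omega) p hp n hn
  rcases Nat.lt_or_ge d (1932 + 1) with h47 | h47
  · exact gxt_form_twelve_YV d (by omega) (by omega) p hp n hn
  rcases Nat.lt_or_ge d (1972 + 1) with h48 | h48
  · exact gxt_form_twelve_YW d (by omega) (by omega) p hp n hn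
  rcases Nat.lt_or_ge d (2012 + 1) with h49 | h49
  · exact gxt_form_twelve_YX d (by omega) (by omega) p hp n hn
  rcases Nat.lt_or_ge d (2052 + 1) with h50 | h50
  · exact gxt_form_twelve_YY d (by omega) (by omega) p hp n hn
  rcases Nat.lt_or_ge d (2092 + 1) with h51 | h51
  · exact gxt_form_twelve_YZ d (by omega) (by omega) p hp n hn
  rcases Nat.lt_or_ge d (2132 + 1) with h52 | h52
  · exact gxt_form_twelve_XA d (by omega) (by omega) p hp n hn
  rcases Nat.lt_or_ge d (2172 + 1) with h53 | h53
  · exact gxt_form_twelve_XB d (by omega) (by omega) p hp n hn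
  rcases Nat.lt_or_ge d (2212 + 1) with h54 | h54
  · exact gxt_form_twelve_XC d (by omega) (by omega) p hp n hn
  rcases Nat.lt_or_ge d (2252 + 1) with h55 | h55
  · exact gxt_form_twelve_XD d (by omega) (by omega) p hp n hn
  rcases Nat.lt_or_ge d (2292 + 1) with h56 | h56
  · exact gxt_form_twelve_XE d (by omega) (by omega) p hp n hn
  rcases Nat.lt_or_ge d (2332 + 1) with h57 | h57
  · exact gxt_form_twelve_XF d (by omega) (by omega) p hp n hn
  rcases Nat.lt_or_ge d (2372 + 1) with h58 | h58
  · exact gxt_form_twelve_XG d (by omega) (by omega) p hp n hn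
  rcases Nat.lt_or_ge d (2412 + 1) with h59 | h59
  · exact gxt_form_twelve_XH d (by omega) (by omega) p hp n hn
  rcases Nat.lt_or_ge d (2452 + 1) with h60 | h60
  · exact gxt_form_twelve_XI d (by omega) (by omega) p hp n hn
  rcases Nat.lt_or_ge d (2492 + 1) with h61 | h61
  · exact gxt_form_twelve_XJ d (by omega) (by omega) p hp n hn
  rcases Nat.lt_or_ge d (2532 + 1) with h62 | h62
  · exact gxt_form_twelve_XK d (by omega) (by omega) p hp n hn
  rcases Nat.lt_or_ge d (2572 + 1) with h63 | h63
  · exact gxt_form_twelve_XL d (by omega) (by omega) p hp n hn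
  rcases Nat.lt_or_ge d (2612 + 1) with h64 | h64
  · exact gxt_form_twelve_XM d (by omega) (by omega) p hp n hn
  rcases Nat.lt_or_ge d (2652 + 1) with h65 | h65
  · exact gxt_form_twelve_XN d (by omega) (by omega) p hp n hn
  · exact gxt_form_twelve_XO d (by omega) hd2 p hp n hn

end ThmN

end PercRepro
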